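import Summits.QuantumFields.BalabanUV.T4Continuum.Support.NE7InteriorInduction
import Summits.QuantumFields.BalabanUV.T4Continuum.Support.NE3CurlStability
import Summits.QuantumFields.BalabanUV.T4Continuum.Support.NE3HessShapes
import Literature.MathematicalPhysics.QuantumFieldTheory.Balaban1983to89.T4ConvexResponse
import HarnessLib

/-!
# NE7OneStepOfCritical — ONE-STEP = CRIT-ONE-STEP ∧ CONV-ONE-STEP: the `hstep` binder of `NE7InteriorInduction` (a GLOBAL constrained
# minimiser with small field, [Balaban1985Variational] Thm 1 (8) in the closed-class dictionary) FOLLOWS from the existence of a small-field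
# admissible configuration that is CONVEXLY DOMINATED along the exponential segment to every competitor — and that convexity clause is reduced
# to three named letters: a Poincaré bound for the segment's direction at the left end, the plaquette radius along the segment, and the
# left-end slop (criticality up to the normal part)

Cell `pub-balaban`, rung (B)+1 sub-cell t4, lineage `b2b-balaban-t4-ne7-p1`, generation 66 (CRUX PROVER NE7 #1); hunt (h10) «ONE-STEP = CRIT ∧ CONV»,
memo `t4/b2b-balaban-t4-ne7-p1-g66/HUNT-H10-TWO-ROADS.md` §1–§2.  File F1 (with F2 `NE7SegmentPlaquetteRadius` of this generation).

WHY.  After gen 64–65 route 1's (A)-bill at curved data is X-A4 ∧ ONE-STEP, ONE-STEP being the `hstep` binder of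
`NE7InteriorInduction.interior_exists_all_levels`: «given an ADMISSIBLE competitor `U₀` of level `k+1` with `SmallField U₀ (δ(L^k)^{−2})`, SOME
`(k+1)`-level constrained minimiser — an `IsMinimiser`, i.e. a GLOBAL minimiser of the level action over the CLOSED class `admissible (sfClass d L N ε)
L (k+1) V` — is `SmallField · (δ(L^{k+1})^{−2})`».  The print ([Balaban1985Variational] Thm 1 p. 279 with Prop. 7 p. 299) delivers a CRITICAL orbit
(«a second order differential … is positive definite. Hence A′ = 0 is a minimum»; «at most one critical orbit in the space (6)»), located in
`𝔘_k(B₃ε₁)`: the LOCAL reading.  The passage LOCAL → GLOBAL over the closed class (cell reading D-B11-2, memo H8 §1) is a convexity argument along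
the segment from the critical configuration to the competitor — exactly the segment machinery row NE3's road P3 built (`NE3HessForm`,
`NE3HessBounds.hess_self_ge`, `NE3CurlStability.hess_self_ge_vary`, `T4ConvexResponse.taylor_lower`).  THIS FILE performs the split and the
reduction, over the tree's objects and with every analytic input a DISPLAYED hypothesis in the exact currency of its supplier:
§1 **`fineAction_le_vary_of_convex`** — if `c ≤ hess (U e^{tX}) X X W` on `[0,1]` and `−κ ≤ dAction U X W` with `κ ≤ c∕2`, then
   `A_W(U) ≤ A_W(U e^{X})` (`taylor_lower` on `NE3HessForm.segment_derivData`; NO minimality, NO tangency assumed);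
§2 **`isMinimiser_of_segmentData`** — an admissible `U♯` such that every admissible `U′` is reached, up to `levelAction (U♯e^{X}) ≤ levelAction U′`
   (the supplier's gauge representative), by a skew `X` carrying the two inequalities of §1 on the period window IS an `IsMinimiser`;
§3 **`oneStep_of_critSegment`** — hence the ONE-STEP binder from CRIT-ONE-STEP-WITH-SEGMENT-DATA («given the competitor, SOME admissible `U♯` with
   `SmallField U♯ (δ(L^{k+1})^{−2})` and the segment data against every admissible `U′`»), and **`interior_exists_all_levels_of_critSegment`** ∕
   **`hint_of_critSegment`** — (8)∃ at every level from it (gen 64's induction `interior_exists_all_levels` ∕ `hint_of_oneStep` BY NAME);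
§4 **`hess_vary_ge_of_poincare`** — the convexity letter `c` FROM THREE LETTERS: a Poincaré bound `m·dirSq X ≤ curlSq U♯ X` for THE SEGMENT'S
   DIRECTION at the left end, the plaquette radius `a′` of `U♯e^{tX}` along the segment (F2 `NE7SegmentPlaquetteRadius.smallField_vary_segment_class`
   supplies `a′ = a + 7α²` from the two endpoints), and the sup `α` of `X`: `c = ((m∕2 − 576d(e^{α} − 1)²)∕card n − 28d·a′)·dirSq X` on the period
   window (`hess_self_ge_vary` + the torus bond count `NE3HessShapes.sum_plaqsOf_bondSq_le`); **`isMinimiser_of_poincare_slop`** — §2 with §4 plugged in.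
WHAT THE LETTERS ARE (memo H10 §2; not proved here).  For the pair (`U♯` critical along the tangent space — the tree's
`NE7MinimiserTensionPairing.critical_of_interior_isMinimiser` ∕ `NE3CurlPairedResidualMulti.hasDerivAt_fineAction_vary_multiLevel` give it for interior
minimisers; CRIT-ONE-STEP asks it of a constructed configuration — and `U′` admissible): the representative `X` with `U′ ∼ U♯e^{X}` of sup
`α = O(ε·L^{−(k+1)})` is [Balaban1985Variational] Prop. 2 TYPE (row NE3's `NE3HessShapes.RelRep` ∕ `NE3DecomposedRep*` shapes); the Poincaré letter for
`X = X_T + X_N` (tangent + normal) is row NE3's k-uniform CLASS-LEVEL (P♮)_W `NE3ClassSlicePoincare.classSlicePoincare_of_lines` on `X_T` plus the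
quadratic smallness of `X_N` (the second-order remainder of the average, `NE3QuadRemainder*`); the slop letter `κ` is criticality on `X_T` plus
`|dAction U♯ X_N| ≤ (radius of U♯)·O(‖X_N‖)`.  CRIT-ONE-STEP itself (existence of the critical `U♯` in `SmallField · (δ(L^{k+1})^{−2})`) is the content
of [Balaban1985Variational] Sects. B–E (contraction) — memo H10 §1 (two roads) — NOT in the tree.
HONEST FRAMING (page 1): [folklore] convexity bookkeeping over HYPOTHESES; nothing is asserted about Bałaban's minimisers; 0 def, 0 sorry; NOT
ONE-STEP, NOT NE7; spine 0∕9; finite T⁴ rung (B)+1 — NOT infinite volume, NOT mass gap, NOT Clay.  Continuum YM on T⁴ ⇐ BetaPertH ∧ nine spine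
estimates (0/9 proved); BetaPertH ⇐ (D1) ∧ (D4) ∧ CAP+tail; G-an2-4 gates asym, D1 and NE2/3/4.
-/

set_option autoImplicit false

open scoped BigOperators Matrix.Norms.L2Operator
open NormedSpace Finset Set

namespace Summit.QuantumFields.BalabanUV.T4Continuum.NE7OneStepOfCritical

open Literature.MathematicalPhysics.QuantumFieldTheory.Balaban1983to89
open B7Prop1Explicit B7Prop2Explicit MatrixLog UnitaryModel
open T4AveragingDeficitWall (IsUnitaryCfg IsSkewDir SmallField fineAction vary curl curlSq dirSq vary_zero)
open T4AveragingDeficitWallBoundary (IsPeriodicCfg periodBox)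
open AveragingDeficitPeriodicCounting (IsPeriodicDir)
open AveragingDeficitPlaqDeriv (vary_isUnitaryCfg)
open T4ConvexResponse (taylor_lower)
open MinimalActionLevels (levelAction perWin stepWt stepWt_pos)
open MinimalActionSandwich (IsMinimiser admissible)
open MinimalActionRate (sfClass)
open NE3HessForm (hess dAction segment_derivData)
open NE3HessBounds (bondSq)
open NE3HessShapes (plaqsOf sum_plaqsOf_bondSq_le curlSq_eq_sum_plaqsOf)
open NE3CurlStability (hess_self_ge_vary)
open NE7InteriorInduction (interior_exists_all_levels hint_of_oneStep)

noncomputable section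

variable {d : ℕ} {n : Type*} [Fintype n] [DecidableEq n]

/-! ## §1 Convexity along the exponential segment gives the action comparison -/

/-- **`A_W(U) ≤ A_W(U e^{X})` FROM CONVEXITY ALONG THE SEGMENT AND A SMALL LEFT-END SLOPE**: if `c ≤ hess (U e^{tX}) X X W` for `t ∈ [0,1]`,
`−κ ≤ dAction U X W` and `κ ≤ c∕2`, then `fineAction U W ≤ fineAction (U e^{X}) W` (`taylor_lower`: `f(1) − f(0) ≥ f′(0) + c∕2`).  No minimality,
no tangency, no smallness is assumed. [folklore] -/
theorem fineAction_le_vary_of_convex (V : Site d → Fin d → (Matrix n n ℂ)ˣ) (X : Site d → Fin d → Matrix n n ℂ)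
    (W : Finset (T4AveragingDeficitWall.Plaq d)) {c κ : ℝ} (hconv : ∀ t ∈ Icc (0 : ℝ) 1, c ≤ hess (vary V X t) X X W)
    (hleft : -κ ≤ dAction V X W) (hκ : κ ≤ c / 2) : fineAction V W ≤ fineAction (vary V X 1) W := by
  obtain ⟨h1, h2⟩ := segment_derivData V X W
  have h := taylor_lower h1 h2 hconv
  rw [vary_zero] at h
  linarith

/-- The level-action form: `levelAction U ≤ levelAction (U e^{X})` under the same segment data on the period window `perWin d (N·L^k)` (`L ≥ 1`).
[folklore] -/
theorem levelAction_le_vary_of_convex {L : ℕ} (hL : 1 ≤ L) (N k : ℕ) (V : Site d → Fin d → (Matrix n n ℂ)ˣ)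
    (X : Site d → Fin d → Matrix n n ℂ) {c κ : ℝ} (hconv : ∀ t ∈ Icc (0 : ℝ) 1, c ≤ hess (vary V X t) X X (perWin d (N * L ^ k)))
    (hleft : -κ ≤ dAction V X (perWin d (N * L ^ k))) (hκ : κ ≤ c / 2) :
    levelAction d L N k V ≤ levelAction d L N k (vary V X 1) := by
  unfold levelAction
  have hw : 0 < ((stepWt d L)⁻¹) ^ k := pow_pos (inv_pos.mpr (stepWt_pos (d := d) L hL)) _
  exact mul_le_mul_of_nonneg_left (fineAction_le_vary_of_convex V X _ hconv hleft hκ) hw.le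

/-! ## §2 CONV-ONE-STEP: segment data against every competitor make an admissible configuration a GLOBAL minimiser -/

/-- **`IsMinimiser` FROM SEGMENT DATA.**  Let `U♯ ∈ admissible 𝒞 L k V` (`L ≥ 1`) and suppose every admissible `U′` admits a skew direction `X`
and letters `c, κ` with: `levelAction (U♯e^{X}) ≤ levelAction U′` (the supplier's gauge representative of `U′` over `U♯`), `c ≤ hess (U♯e^{tX}) X X`
on `[0,1]` over the period window, `−κ ≤ dAction U♯ X` there, and `κ ≤ c∕2`.  Then `U♯` is an `IsMinimiser d 𝒞 L N k V` — a GLOBAL minimiser over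
the closed admissible set.  (Reading D-B11-2 of [Balaban1985Variational] Thm 1: LOCAL → GLOBAL by convexity along segments.) [folklore] -/
theorem isMinimiser_of_segmentData {𝒞 : ℕ → Set (Site d → Fin d → (Matrix n n ℂ)ˣ)} {L N k : ℕ} (hL : 1 ≤ L)
    {V Us : Site d → Fin d → (Matrix n n ℂ)ˣ} (hmem : Us ∈ admissible 𝒞 L k V)
    (hseg : ∀ U' ∈ admissible 𝒞 L k V, ∃ (X : Site d → Fin d → Matrix n n ℂ) (c κ : ℝ),
      levelAction d L N k (vary Us X 1) ≤ levelAction d L N k U' ∧ κ ≤ c / 2 ∧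
      (∀ t ∈ Icc (0 : ℝ) 1, c ≤ hess (vary Us X t) X X (perWin d (N * L ^ k))) ∧ -κ ≤ dAction Us X (perWin d (N * L ^ k))) :
    IsMinimiser d 𝒞 L N k V Us := by
  refine ⟨hmem, fun U' hU' => ?_⟩
  obtain ⟨X, c, κ, hrep, hκ, hconv, hleft⟩ := hseg U' hU'
  exact (levelAction_le_vary_of_convex hL N k Us X hconv hleft hκ).trans hrep

/-! ## §3 ONE-STEP ⇐ CRIT-ONE-STEP WITH SEGMENT DATA, and (8)∃ at every level from it -/

/-- **THE `hstep` BINDER OF `NE7InteriorInduction.interior_exists_all_levels` FROM CRIT-ONE-STEP-WITH-SEGMENT-DATA**: if for every level `k` and every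
admissible competitor `U₀` of level `k+1` with `SmallField U₀ (δ(L^k)^{−2})` there is an ADMISSIBLE `U♯` with `SmallField U♯ (δ(L^{k+1})^{−2})` carrying
§2's segment data against every admissible `U′` of level `k+1`, then ONE-STEP holds (for the class family `sfClass d L N ε`; any family would do).
[folklore] -/
theorem oneStep_of_critSegment {L N : ℕ} (hL : 1 ≤ L) {ε δ : ℝ} {V : Site d → Fin d → (Matrix n n ℂ)ˣ}
    (hcrit : ∀ (k : ℕ) (U₀ : Site d → Fin d → (Matrix n n ℂ)ˣ), U₀ ∈ admissible (sfClass d L N ε) L (k + 1) V →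
      SmallField U₀ (δ / ((L : ℝ) ^ k) ^ 2) →
      ∃ Us : Site d → Fin d → (Matrix n n ℂ)ˣ, Us ∈ admissible (sfClass d L N ε) L (k + 1) V ∧
        SmallField Us (δ / ((L : ℝ) ^ (k + 1)) ^ 2) ∧
        ∀ U' ∈ admissible (sfClass d L N ε) L (k + 1) V, ∃ (X : Site d → Fin d → Matrix n n ℂ) (c κ : ℝ),
          levelAction d L N (k + 1) (vary Us X 1) ≤ levelAction d L N (k + 1) U' ∧ κ ≤ c / 2 ∧
          (∀ t ∈ Icc (0 : ℝ) 1, c ≤ hess (vary Us X t) X X (perWin d (N * L ^ (k + 1)))) ∧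
          -κ ≤ dAction Us X (perWin d (N * L ^ (k + 1)))) :
    ∀ (k : ℕ) (U₀ : Site d → Fin d → (Matrix n n ℂ)ˣ), U₀ ∈ admissible (sfClass d L N ε) L (k + 1) V →
      SmallField U₀ (δ / ((L : ℝ) ^ k) ^ 2) →
      ∃ U, IsMinimiser d (sfClass d L N ε) L N (k + 1) V U ∧ SmallField U (δ / ((L : ℝ) ^ (k + 1)) ^ 2) := by
  intro k U₀ hU₀ hU₀a
  obtain ⟨Us, hmem, hUsa, hseg⟩ := hcrit k U₀ hU₀ hU₀a
  exact ⟨Us, isMinimiser_of_segmentData hL hmem hseg, hUsa⟩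

/-- **INTERIOR MINIMISERS AT EVERY LEVEL FROM CRIT-ONE-STEP-WITH-SEGMENT-DATA** (gen 64's induction `interior_exists_all_levels` BY NAME): datum `V`
unitary, `N`-periodic, `SmallField V δ_V`, `0 ≤ δ_V ≤ δ`, `δ·L² ≤ ε`, `L ≥ 1`. [folklore] -/
theorem interior_exists_all_levels_of_critSegment {L N : ℕ} (hL : 1 ≤ L) {ε δ δV : ℝ} (hδV : 0 ≤ δV) (hδVδ : δV ≤ δ)
    (hδL : δ * (L : ℝ) ^ 2 ≤ ε) {V : Site d → Fin d → (Matrix n n ℂ)ˣ} (hVu : IsUnitaryCfg V) (hVp : IsPeriodicCfg V (N : ℤ))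
    (hVδ : SmallField V δV)
    (hcrit : ∀ (k : ℕ) (U₀ : Site d → Fin d → (Matrix n n ℂ)ˣ), U₀ ∈ admissible (sfClass d L N ε) L (k + 1) V →
      SmallField U₀ (δ / ((L : ℝ) ^ k) ^ 2) →
      ∃ Us : Site d → Fin d → (Matrix n n ℂ)ˣ, Us ∈ admissible (sfClass d L N ε) L (k + 1) V ∧
        SmallField Us (δ / ((L : ℝ) ^ (k + 1)) ^ 2) ∧
        ∀ U' ∈ admissible (sfClass d L N ε) L (k + 1) V, ∃ (X : Site d → Fin d → Matrix n n ℂ) (c κ : ℝ),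
          levelAction d L N (k + 1) (vary Us X 1) ≤ levelAction d L N (k + 1) U' ∧ κ ≤ c / 2 ∧
          (∀ t ∈ Icc (0 : ℝ) 1, c ≤ hess (vary Us X t) X X (perWin d (N * L ^ (k + 1)))) ∧
          -κ ≤ dAction Us X (perWin d (N * L ^ (k + 1)))) :
    ∀ k : ℕ, ∃ U, IsMinimiser d (sfClass d L N ε) L N k V U ∧ SmallField U (δ / ((L : ℝ) ^ k) ^ 2) :=
  interior_exists_all_levels hL hδV hδVδ hδL hVu hVp hVδ (oneStep_of_critSegment hL hcrit)

/-- **(8)∃ FROM CRIT-ONE-STEP-WITH-SEGMENT-DATA** over `dom = {unitary, N-periodic, SmallField · δ_V}` (`0 ≤ δ_V ≤ δ < ε`, `δ·L² ≤ ε`): the `hint`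
binder of `NE7InteriorMinimiserDocking.hminE_of_interior_exists` (gen 64's `hint_of_oneStep` BY NAME). [folklore] -/
theorem hint_of_critSegment {L N : ℕ} (hL : 1 ≤ L) {ε δ δV : ℝ} (hδV : 0 ≤ δV) (hδVδ : δV ≤ δ) (hδε : δ < ε)
    (hδL : δ * (L : ℝ) ^ 2 ≤ ε)
    (hcrit : ∀ V : Site d → Fin d → (Matrix n n ℂ)ˣ, IsUnitaryCfg V → IsPeriodicCfg V (N : ℤ) → SmallField V δV →
      ∀ (k : ℕ) (U₀ : Site d → Fin d → (Matrix n n ℂ)ˣ), U₀ ∈ admissible (sfClass d L N ε) L (k + 1) V →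
        SmallField U₀ (δ / ((L : ℝ) ^ k) ^ 2) →
        ∃ Us : Site d → Fin d → (Matrix n n ℂ)ˣ, Us ∈ admissible (sfClass d L N ε) L (k + 1) V ∧
          SmallField Us (δ / ((L : ℝ) ^ (k + 1)) ^ 2) ∧
          ∀ U' ∈ admissible (sfClass d L N ε) L (k + 1) V, ∃ (X : Site d → Fin d → Matrix n n ℂ) (c κ : ℝ),
            levelAction d L N (k + 1) (vary Us X 1) ≤ levelAction d L N (k + 1) U' ∧ κ ≤ c / 2 ∧
            (∀ t ∈ Icc (0 : ℝ) 1, c ≤ hess (vary Us X t) X X (perWin d (N * L ^ (k + 1)))) ∧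
            -κ ≤ dAction Us X (perWin d (N * L ^ (k + 1)))) :
    ∀ V ∈ {V : Site d → Fin d → (Matrix n n ℂ)ˣ | IsUnitaryCfg V ∧ IsPeriodicCfg V (N : ℤ) ∧ SmallField V δV}, ∀ k : ℕ,
      ∃ U : Site d → Fin d → (Matrix n n ℂ)ˣ, IsMinimiser d (sfClass d L N ε) L N k V U ∧
        ∃ a : ℝ, 0 ≤ a ∧ a < ε / ((L : ℝ) ^ k) ^ 2 ∧ SmallField U a :=
  hint_of_oneStep hL hδV hδVδ hδε hδL fun V hVu hVp hVδ => oneStep_of_critSegment hL (hcrit V hVu hVp hVδ)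

/-! ## §4 The convexity letter from three letters: Poincaré for the direction, radius along the segment, sup of the direction -/

/-- **THE CONVEXITY LETTER.**  For unitary `U`, skew `M`-periodic `X` (`M ≥ 1`) with `‖X(b)‖ ≤ α`, a POINCARÉ BOUND FOR THE SEGMENT'S DIRECTION AT
THE LEFT END `m·dirSq X (periodBox M) ≤ curlSq U X (periodBox M)` (`α ≥ 0`), and the plaquette radius `a′ ≥ 0` of `U e^{tX}`:
`((m∕2 − 576d(e^{α} − 1)²)∕card n − 28d·a′)·dirSq X (periodBox M) ≤ hess (U e^{tX}) X X (plaqsOf (periodBox M))` for `t ∈ [0,1]`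
(`hess_self_ge_vary` with the torus bond count `Σ bondSq ≤ 4d·dirSq`). [folklore] -/
theorem hess_vary_ge_of_poincare [Nonempty n] {M : ℕ} (hM : 1 ≤ M) {U : Site d → Fin d → (Matrix n n ℂ)ˣ} (hU : IsUnitaryCfg U)
    {X : Site d → Fin d → Matrix n n ℂ} (hX : IsSkewDir X) (hXP : IsPeriodicDir X M) {α m a' : ℝ} (hα : 0 ≤ α)
    (hXα : ∀ x κ, ‖X x κ‖ ≤ α) (hP : m * dirSq X (periodBox M) ≤ curlSq U X (periodBox M)) {t : ℝ} (ht : t ∈ Icc (0 : ℝ) 1) (ha' : 0 ≤ a')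
    (hrad : SmallField (vary U X t) a') :
    ((m / 2 - 576 * d * (Real.exp α - 1) ^ 2) / (Fintype.card n : ℝ) - 28 * d * a') * dirSq X (periodBox M)
      ≤ hess (vary U X t) X X (plaqsOf (periodBox (d := d) M)) := by
  obtain ⟨ht0, ht1⟩ := ht
  have h := hess_self_ge_vary hU hX hXα t hX hrad (plaqsOf (periodBox (d := d) M))
  have hb := sum_plaqsOf_bondSq_le (n := n) hM hXP
  rw [← curlSq_eq_sum_plaqsOf] at h
  have hN : (0 : ℝ) < Fintype.card n := Nat.cast_pos.mpr Fintype.card_pos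
  have hD : 0 ≤ dirSq X (periodBox (d := d) M) := by unfold dirSq; positivity
  have hB : 0 ≤ ∑ p ∈ plaqsOf (periodBox (d := d) M), bondSq X p := Finset.sum_nonneg fun p _ => by
    unfold bondSq NE3HessBounds.bondSqAt; positivity
  -- `(e^{|t|α} − 1)² ≤ (e^{α} − 1)²` on `[0,1]`
  have hexp : (Real.exp (|t| * α) - 1) ^ 2 ≤ (Real.exp α - 1) ^ 2 := by
    rw [abs_of_nonneg ht0]
    have h1 : Real.exp (t * α) ≤ Real.exp α := Real.exp_le_exp.mpr (by nlinarith)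
    have h2 : 1 ≤ Real.exp (t * α) := Real.one_le_exp (mul_nonneg ht0 hα)
    nlinarith
  -- assemble
  have hnum : (m * dirSq X (periodBox (d := d) M)) / 2 - 144 * (Real.exp α - 1) ^ 2 * (4 * d * dirSq X (periodBox (d := d) M))
      ≤ curlSq U X (periodBox (d := d) M) / 2 - 144 * (Real.exp (|t| * α) - 1) ^ 2 * ∑ p ∈ plaqsOf (periodBox (d := d) M), bondSq X p := by
    have e1 : 144 * (Real.exp (|t| * α) - 1) ^ 2 * ∑ p ∈ plaqsOf (periodBox (d := d) M), bondSq X p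
        ≤ 144 * (Real.exp α - 1) ^ 2 * (4 * d * dirSq X (periodBox (d := d) M)) := by
      have := mul_le_mul hexp hb hB (sq_nonneg _)
      linarith
    linarith
  have hdiv := div_le_div_of_nonneg_right hnum hN.le
  have e2 : 7 * a' * ∑ p ∈ plaqsOf (periodBox (d := d) M), bondSq X p ≤ 7 * a' * (4 * d * dirSq X (periodBox (d := d) M)) :=
    mul_le_mul_of_nonneg_left hb (by positivity)
  have e3 : ((m / 2 - 576 * d * (Real.exp α - 1) ^ 2) / (Fintype.card n : ℝ) - 28 * d * a') * dirSq X (periodBox (d := d) M)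
      = ((m * dirSq X (periodBox (d := d) M)) / 2 - 144 * (Real.exp α - 1) ^ 2 * (4 * d * dirSq X (periodBox (d := d) M)))
          / (Fintype.card n : ℝ) - 7 * a' * (4 * d * dirSq X (periodBox (d := d) M)) := by
    field_simp
    ring
  rw [e3]
  linarith

/-- **CONV-ONE-STEP FROM THE THREE LETTERS AND THE SLOP** (§2 with §4 plugged in).  `U♯ ∈ admissible 𝒞 L k V` unitary (`L, N ≥ 1`); every admissible
`U′` is represented by a skew `(N·L^k)`-periodic `X` with `‖X(b)‖ ≤ α` (`α ≥ 0`), `levelAction (U♯e^{X}) ≤ levelAction U′`, a Poincaré letter `m` for `X` at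
`U♯`, a radius `a′ ≥ 0` along the segment, a slop `−κ·dirSq X ≤ dAction U♯ X` on the period window, and the numeric line
`2κ ≤ (m∕2 − 576d(e^{α} − 1)²)∕card n − 28d·a′`.  Then `IsMinimiser d 𝒞 L N k V U♯`. [folklore] -/
theorem isMinimiser_of_poincare_slop [Nonempty n] {𝒞 : ℕ → Set (Site d → Fin d → (Matrix n n ℂ)ˣ)} {L N k : ℕ} (hL : 1 ≤ L) (hN : 1 ≤ N)
    {V Us : Site d → Fin d → (Matrix n n ℂ)ˣ} (hmem : Us ∈ admissible 𝒞 L k V) (hUs : IsUnitaryCfg Us)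
    (hrep : ∀ U' ∈ admissible 𝒞 L k V, ∃ (X : Site d → Fin d → Matrix n n ℂ) (α m a' κ : ℝ),
      IsSkewDir X ∧ IsPeriodicDir X ((N * L ^ k : ℕ) : ℤ) ∧ 0 ≤ α ∧ (∀ x μ, ‖X x μ‖ ≤ α) ∧
      levelAction d L N k (vary Us X 1) ≤ levelAction d L N k U' ∧
      m * dirSq X (periodBox (N * L ^ k)) ≤ curlSq Us X (periodBox (N * L ^ k)) ∧
      0 ≤ a' ∧ (∀ t ∈ Icc (0 : ℝ) 1, SmallField (vary Us X t) a') ∧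
      -(κ * dirSq X (periodBox (N * L ^ k))) ≤ dAction Us X (perWin d (N * L ^ k)) ∧
      2 * κ ≤ (m / 2 - 576 * d * (Real.exp α - 1) ^ 2) / (Fintype.card n : ℝ) - 28 * d * a') :
    IsMinimiser d 𝒞 L N k V Us := by
  have hN0 : 0 < N := hN
  have hL0 : 0 < L := hL
  have hM : 0 < N * L ^ k := Nat.mul_pos hN0 (Nat.pow_pos hL0)
  refine isMinimiser_of_segmentData hL hmem fun U' hU' => ?_
  obtain ⟨X, α, m, a', κ, hXs, hXP, hα, hXα, hle, hP, ha', hrad, hslop, hline⟩ := hrep U' hU'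
  have hD : 0 ≤ dirSq X (periodBox (d := d) (N * L ^ k)) := by unfold dirSq; positivity
  refine ⟨X, ((m / 2 - 576 * d * (Real.exp α - 1) ^ 2) / (Fintype.card n : ℝ) - 28 * d * a') * dirSq X (periodBox (N * L ^ k)),
    κ * dirSq X (periodBox (N * L ^ k)), hle, ?_, fun t ht => ?_, hslop⟩
  · -- `κ·D ≤ c·D∕2` from the numeric line and `D ≥ 0`
    have := mul_le_mul_of_nonneg_right hline hD
    linarith
  · -- `perWin d M = plaqsOf (periodBox M)` (both `periodBox M ×ˢ univ`; row NE3's `NE3EnergyHessCont.perWin_eq_plaqsOf`)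
    have e : perWin d (N * L ^ k) = plaqsOf (periodBox (d := d) (N * L ^ k)) := rfl
    rw [e]
    exact hess_vary_ge_of_poincare hM hUs hXs hXP hα hXα hP ht ha' (hrad t ht)

end

end Summit.QuantumFields.BalabanUV.T4Continuum.NE7OneStepOfCritical
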